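import Summits.CriticalPhenomena.PercolationContinuityZ3.Theorems.PercNearOneGluingNoHeavyQuantClusterLawRevealmentModulus
import Summits.CriticalPhenomena.PercolationContinuityZ3.Theorems.PercNearOneGluingNoHeavyQuantThreeDisplays
import Summits.CriticalPhenomena.PercolationContinuityZ3.Theorems.PercNearOneGluingNoHeavyQuantCriticalProbLeHalf
import Literature.Probability.Percolation.NonBacktrackingPathCounting
import Literature.Probability.LatticeModels.ThermodynamicLimit
import HarnessLib

/-!
# QUANT lane (p4 gen 22): the REVEALMENT total-variation modulus of the cluster law, V — the explicit `ℤ³` display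

builds on p205010 (kernel theorem, internal audit signed; external expert review pending) — used through the lane's
one-arm rate of record `Quant.EpsSharp.oneArm_rate_Z3_three_sharp` (`θ_n(p_c(ℤ³)) ≤ (1−2⁻¹⁹⁸⁶)^⌊(log*₂ n − 6)/2⌋`).

Sequel of `…QuantClusterLawRevealmentModulus` (base form `2θ_n(q) + 2(p−q)√(2dχ_n^Λ(p)/(4q(1−p)))`) and the `ℤ³` companion of
`…QuantClusterLawCriticalModulusZ3` (`(1−2⁻¹⁹⁸⁶)^⌊(log*₂ s − 8)/2⌋ + 12·s·|p − p_c|`, `s` = VOLUME truncation).  With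
`χ_n^Λ ≤ |Λ_n| = (2n+1)³` (`card_box`), `1/5 ≤ p_c(ℤ³) ≤ 1/2` (`inv_le_criticalProbI`, `Quant.criticalProbI_le_half`) and
`|p − p_c| ≤ 1/10`:

* **`abs_sub_criticalProbI_le_revealment_Z3`**: for EVERY cluster event `B` (no measurability), every `n`, every `p` with
  `|p − p_c(ℤ³)| ≤ 1/10`:
  `|P_{p_c}(B) − P_p(B)| ≤ 2(1 − 2⁻¹⁹⁸⁶)^⌊(log*₂ n − 6)/2⌋ + 11·√((2n+1)³)·|p − p_c|`
  — RADIUS truncation `n` with the linear term `n^{3/2}` in place of the volume display's `s ≍ n³`: the same class (log*, through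
  the tail term only) with a strictly smaller linear term.  HONEST: an explicit modulus of continuity in total variation of
  `p ↦ Law_p(C(0))` at `p_c(ℤ³)`, uniformly over events, of class log*; no rate is claimed or improved.
[cite: ODonnell2014, §8.6 OS Inequality]
-/

noncomputable section

namespace Summit.CriticalPhenomena.PercolationContinuityZ3.Theorems.ClusterLaw

open MeasureTheory Finset Literature.Probability.Percolation Literature.Probability.LatticeModels
open Literature.Probability.Percolation.OneArmOSSS
open scoped Classical

/-- `cl3⁻¹ 𝒜`: the cluster event `{ω | C(0)(ω) ∈ 𝒜}` on `ℤ³`. -/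
local notation3 (prettyPrint := false) "cl3⁻¹" 𝒜:arg =>
  (fun ω : BondConfig (Site 3) => openCluster ω (0 : Site 3)) ⁻¹' 𝒜

/-- `χΛ3[n, p] = Σ_{a ∈ Λ_n} P_p(0 ↔ a in Λ_n)` on `ℤ³`. -/
local notation3 (prettyPrint := false) "χΛ3[" n ", " p "]" =>
  ∑ a ∈ box 3 n, (bondPercolation (zdGraph 3) p).real (openConnIn (↑(box 3 n) : Set (Site 3)) 0 a)

/-- `θn3[p, n] = P_p(0 ↔ ∂Λ_n)` on `ℤ³`. -/
local notation3 (prettyPrint := false) "θn3[" p ", " n "]" => (bondPercolation (zdGraph 3) p).real (siteToBoundary 3 n)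

/-- `χ_n^Λ(p) ≤ (2n+1)³` on `ℤ³`. -/
theorem boxSusc_le_cube_Z3 (n : ℕ) (p : unitInterval) : χΛ3[n, p] ≤ (2 * (n : ℝ) + 1) ^ 3 := by
  calc χΛ3[n, p] ≤ ∑ _a ∈ box 3 n, (1 : ℝ) := Finset.sum_le_sum fun a _ => measureReal_le_one
    _ = ((box 3 n).card : ℝ) := by simp
    _ = (2 * (n : ℝ) + 1) ^ 3 := by rw [card_box 3 n]; push_cast; ring

/-- The square-root factor of the base form on `ℤ³`: for `q, s > 0` with `qs ≥ 1/20`,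
`√(2·3·χ_n^Λ(r)/(4qs)) ≤ (11/2)·√((2n+1)³)` (`χ_n^Λ ≤ (2n+1)³`, `6/(4/20) = 30 ≤ (11/2)²`). -/
theorem sqrt_boxSusc_le_Z3 (n : ℕ) (r : unitInterval) {q s : ℝ} (hq : 0 < q) (hs : 0 < s) (hqs : 1 / 20 ≤ q * s) :
    Real.sqrt (2 * (3 : ℕ) * χΛ3[n, r] / (4 * (q * s))) ≤ 11 / 2 * Real.sqrt ((2 * (n : ℝ) + 1) ^ 3) := by
  have hX : 0 ≤ (2 * (n : ℝ) + 1) ^ 3 := by positivity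
  have hχ := boxSusc_le_cube_Z3 n r
  have h20 : 0 ≤ 20 * (q * s) - 1 := by linarith
  have h1 : 2 * (3 : ℕ) * χΛ3[n, r] / (4 * (q * s)) ≤ 30 * (2 * (n : ℝ) + 1) ^ 3 := by
    rw [div_le_iff₀ (by positivity)]
    push_cast
    nlinarith [mul_nonneg hX h20]
  calc Real.sqrt (2 * (3 : ℕ) * χΛ3[n, r] / (4 * (q * s)))
      ≤ Real.sqrt (30 * (2 * (n : ℝ) + 1) ^ 3) := Real.sqrt_le_sqrt h1
    _ ≤ Real.sqrt ((11 / 2) ^ 2 * (2 * (n : ℝ) + 1) ^ 3) := Real.sqrt_le_sqrt (by nlinarith)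
    _ = 11 / 2 * Real.sqrt ((2 * (n : ℝ) + 1) ^ 3) := by
        rw [Real.sqrt_mul (by positivity), Real.sqrt_sq (by norm_num)]

/-- **THE EXPLICIT `ℤ³` REVEALMENT MODULUS OF THE CRITICAL CLUSTER LAW**: for every cluster event `B = {C(0) ∈ 𝒜}` (no
measurability), every `n` and every `p` with `|p − p_c(ℤ³)| ≤ 1/10`:
`|P_{p_c}(B) − P_p(B)| ≤ 2(1 − 2⁻¹⁹⁸⁶)^⌊(log*₂ n − 6)/2⌋ + 11·√((2n+1)³)·|p − p_c(ℤ³)|`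
(one-arm rate of record at `p_c(ℤ³)` — builds on p205010 — plus the revealment term with `χ_n^Λ ≤ (2n+1)³`,
`1/5 ≤ p_c ≤ 1/2`).  The right side tends to `0` as `p → p_c` after choosing `n = n(p) → ∞` slowly.
[cite: ODonnell2014, §8.6 OS Inequality] -/
theorem abs_sub_criticalProbI_le_revealment_Z3 (p : unitInterval) (hp : |(p : ℝ) - criticalProbI 3| ≤ 1 / 10)
    (𝒜 : Set (Set (Site 3))) (n : ℕ) :
    |(bondPercolation (zdGraph 3) (criticalProbI 3)).real (cl3⁻¹ 𝒜) - (bondPercolation (zdGraph 3) p).real (cl3⁻¹ 𝒜)| ≤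
      2 * (1 - (1 / 2 : ℝ) ^ 1986) ^ ((Quant.logStar 2 n - 6) / 2) +
        11 * Real.sqrt ((2 * (n : ℝ) + 1) ^ 3) * |(p : ℝ) - criticalProbI 3| := by
  set B : ℝ := (1 - (1 / 2 : ℝ) ^ 1986) ^ ((Quant.logStar 2 n - 6) / 2) with hB
  have harm : θn3[criticalProbI 3, n] ≤ B := by
    have h := Quant.EpsSharp.oneArm_rate_Z3_three_sharp n
    rw [← hB] at h
    exact h
  clear_value B
  clear hB
  have hhalf : (criticalProbI 3 : ℝ) ≤ 1 / 2 := Quant.criticalProbI_le_half (d := 3) (by norm_num)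
  have hfifth : 1 / 5 ≤ (criticalProbI 3 : ℝ) := by
    have h := inv_le_criticalProbI (d := 3) (by norm_num)
    have e : (1 : ℝ) / (2 * ((3 : ℕ) : ℝ) - 1) = 1 / 5 := by norm_num
    rw [e] at h
    exact h
  have hX : 0 ≤ Real.sqrt ((2 * (n : ℝ) + 1) ^ 3) := Real.sqrt_nonneg _
  rw [abs_le] at hp
  rcases le_total (criticalProbI 3) p with hle | hle
  · -- `p_c ≤ p`: base form with `q = p_c`
    have hle' : (criticalProbI 3 : ℝ) ≤ p := hle
    have hp1 : (p : ℝ) < 1 := by linarith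
    have h := abs_sub_le_revealment_modulus_base (d := 3) (by norm_num) (criticalProbI 3) p (by linarith) hle hp1 𝒜 n
    have hsq := sqrt_boxSusc_le_Z3 n p (q := criticalProbI 3) (s := 1 - p) (by linarith) (by linarith) (by nlinarith)
    have habs : |(p : ℝ) - criticalProbI 3| = p - criticalProbI 3 := abs_of_nonneg (by linarith)
    rw [habs]
    have hmono := mul_le_mul_of_nonneg_left hsq (sub_nonneg.2 hle')
    nlinarith
  · -- `p ≤ p_c`: base form with `q = p`, then `θ_n(p) ≤ θ_n(p_c)`
    have hle' : (p : ℝ) ≤ criticalProbI 3 := hle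
    have hq1 : (criticalProbI 3 : ℝ) < 1 := by linarith
    have h := abs_sub_le_revealment_modulus_base (d := 3) (by norm_num) p (criticalProbI 3) (by linarith) hle hq1 𝒜 n
    have hθ : θn3[p, n] ≤ θn3[criticalProbI 3, n] :=
      DCT16.real_mono_of_isUpperSet (zdGraph 3) (DCT16.isUpperSet_siteToBoundary 3 n)
        (DCT16.measurableSet_siteToBoundary 3 n) hle
    have hsq := sqrt_boxSusc_le_Z3 n (criticalProbI 3) (q := p) (s := 1 - criticalProbI 3)
      (by linarith) (by linarith) (by nlinarith)
    have habs : |(p : ℝ) - criticalProbI 3| = criticalProbI 3 - p := by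
      rw [abs_sub_comm]; exact abs_of_nonneg (by linarith)
    rw [abs_sub_comm, habs]
    have hmono := mul_le_mul_of_nonneg_left hsq (sub_nonneg.2 hle')
    nlinarith

end Summit.CriticalPhenomena.PercolationContinuityZ3.Theorems.ClusterLaw
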